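import Summits.CriticalPhenomena.PercolationContinuityZ3.Theorems.SahiMasterFamilyRigidityR3Steps

/-!
# THEOREM R₃: rigidity of the `t²`-identity `P(U | P₁) + P(U | P₂) ≡ P(U)` (classification-free route to (EQI-3))

Support file of the master-family programme (crux `NoHeavyLowerTail`, stmt-CriticalPhenomena-4575; cell `prim-masterthm`, seat P4,
unit `prim-masterthm-p4-g7`).  Seat document HOME/prim-masterthm-p4/EQI3-RIGIDITY-PROOF.md §3.

For a coordinate `e` shared by two increasing events `U_1, U_2` and avoided by `U_3`, the `p_e²`-coefficient of `E_3(μ_p; 1_U)` is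
`−[P(P_1)P(P_2∩U_3) + P(P_2)P(P_1∩U_3) − P(P_1)P(P_2)P(U_3)]`, `P_i = Piv_e U_i` (`SahiMasterFamilySharedCoordinate`, `topCoeff` at `n = 1`).
This file proves WHEN THAT COEFFICIENT CAN VANISH IDENTICALLY:

* **`rigidity_three`** (THEOREM R₃) — for arbitrary nonempty events `P_1, P_2` and a nonempty, non-sure UP-SET `U`, the identity
  `E_p(1_{P_1})E_p(1_{P_2}1_U) + E_p(1_{P_2})E_p(1_{P_1}1_U) = E_p(1_{P_1})E_p(1_{P_2})E_p(1_U)` for every interior `p` forces, for some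
  `{i,j} = {1,2}`: no coordinate is essential for both `P_i` and `U`, and `P_j ∩ U = ∅`.  (The converse is immediate; the statement is FALSE for
  non-monotone `U`, EQI3-RIGIDITY-PROOF §3 Rem. (i).)
Proof (§3 there): (a) no coordinate is essential for `P_1, P_2, U` simultaneously (degree 3 vs. ≤ 2 in that variable); (b) for `x` essential for
`P_1` and `U`, `P_2` is uncorrelated with the signed section difference `1_{U^{x←1}} − 1_{U^{x←0}}` under every product measure, hence shares no
essential coordinate with it (Fact 1; the `X_x²`-coefficient of the polynomial identity); (c) passing to sections `U^{x←1} ⊇ U` at coordinates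
essential for `U` only, additive separability (Fact 2) shows that not both `P_i` meet `U`; (d) Fact 1 again.  Ingredients: `exPoly`,
`degreeOf_mul_eq`, `ExpectationRigidity`.  HONEST FRAMING: a statement about the zero set of one coefficient of `E_3`; Sahi `C_3` / Kahn's Conj. 5
remain OPEN; (EQI-3) itself is prim-master-conj's theorem `masterFamilyIdentEqIff_three`.  [this work]
-/

noncomputable section

open scoped Classical

namespace Summit.CriticalPhenomena.PercolationContinuityZ3.Theorems

open Finset Function MvPolynomial
open Literature.Computability.AlgebraicComplexity (blockProfile blockProfile_apply)
open Literature.Combinatorics.Sahi2008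
open Literature.Probability.Percolation.BHK2006 (weight)
open Literature.Probability.Percolation.DecisionTree (ind ind_of_mem ind_of_not_mem ind_nonneg)
open SharedCoordinate (Ignores xInd)
open ExpectationRigidity

namespace RigidityR3

variable {ι : Type*} [Fintype ι]

section Assembly

variable {P₁ P₂ : Set (Set ι)}

/-- The identity is symmetric in `P₁, P₂`. [this work] -/
theorem Identity.symm {U : Set (Set ι)} (hI : Identity P₁ P₂ U) : Identity P₂ P₁ U := fun p hp => by
  linear_combination hI p hp

omit [Fintype ι] in
/-- `Δ_x h` ignores `y` whenever `h` does. [this work] -/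
theorem ignores_dsec_of_ignores {x y : ι} {h : Set ι → ℝ} (hy : Ignores y h) : Ignores y (dsec x h) := by
  by_cases hyx : y = x
  · subst hyx; exact ignores_dsec y h
  · intro ω
    simp only [dsec, Pi.sub_apply, fsec, forceAt, cond_true, cond_false]
    rw [Set.insert_comm, hy, ← Set.insert_sdiff_singleton_comm hyx, hy]

/-- **Vanishing mixed difference** at the points avoiding `y, t`. [this work] -/
def Mixed (y t : ι) (h : Set ι → ℝ) : Prop :=
  ∀ ω : Set ι, y ∉ ω → t ∉ ω → h (insert y (insert t ω)) - h (insert t ω) = h (insert y ω) - h ω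

omit [Fintype ι] in
/-- `Mixed` is symmetric. [this work] -/
theorem Mixed.symm {y t : ι} {h : Set ι → ℝ} (hm : Mixed y t h) : Mixed t y h := fun ω ht hy => by
  have := hm ω hy ht
  rw [Set.insert_comm]
  linarith

omit [Fintype ι] in
/-- `Δ_y h` ignores `t` iff the mixed difference in `y, t` vanishes (`y ≠ t`). [this work] -/
theorem ignores_dsec_iff_mixed {y t : ι} (hyt : y ≠ t) (h : Set ι → ℝ) : Ignores t (dsec y h) ↔ Mixed y t h := by
  constructor
  · intro hi ω hy ht
    have := hi ω
    simp only [dsec, Pi.sub_apply, fsec, forceAt, cond_true, cond_false] at this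
    rwa [Set.sdiff_singleton_eq_self (show y ∉ insert t ω from fun h' => (Set.mem_insert_iff.1 h').elim hyt hy),
      Set.sdiff_singleton_eq_self hy] at this
  · intro hm ω
    by_cases ht : t ∈ ω
    · rw [Set.insert_eq_of_mem ht]
    · simp only [dsec, Pi.sub_apply, fsec, forceAt, cond_true, cond_false]
      have key := hm (ω \ {y}) (fun h' => h'.2 rfl) (fun h' => ht h'.1)
      rw [Set.insert_sdiff_singleton, Set.insert_comm, Set.insert_sdiff_singleton, Set.insert_comm t y,
        Set.insert_sdiff_singleton_comm (Ne.symm hyt)] at key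
      linarith

/-- From step (b): for `x` essential for `U` and `P₁`, every `P₂`-essential coordinate is inessential for `Δ_x 1_U`. [this work] -/
theorem ignores_dsec_of_essential (hP₁ : P₁.Nonempty) (hP₂ : P₂.Nonempty) {U : Set (Set ι)} (hU : U.Nonempty) (hI : Identity P₁ P₂ U)
    {x : ι} (hx₁ : ¬ Ignores x (ind P₁)) (hxU : ¬ Ignores x (ind U)) {t : ι} (ht : ¬ Ignores t (ind P₂)) :
    Ignores t (dsec x (ind U)) := by
  have hx₂ : Ignores x (ind P₂) := by
    by_contra h; exact not_all_three hP₁ hP₂ hU hI x hx₁ h hxU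
  have hmul := exPoly_mul_dsec_eq hI x hx₂ hx₁
  have hfor : ∀ p : ι → unitInterval, (∀ e, (p e : ℝ) ∈ Set.Ioo (0 : ℝ) 1) →
      ex (bernoulliWeight p) (ind P₂ * dsec x (ind U)) = ex (bernoulliWeight p) (ind P₂) * ex (bernoulliWeight p) (dsec x (ind U)) := by
    intro p _
    have := congrArg (MvPolynomial.eval fun i => (p i : ℝ)) hmul
    simp only [map_mul, eval_exPoly] at this
    exact this
  exact (ignores_or_ignores_of_forall_interior_ex_mul_eq hfor t).resolve_left ht

omit [Fintype ι] in
/-- `1_{U^{x←1}} = fsec x true 1_U`. [this work] -/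
theorem ind_secAt_true (x : ι) (U : Set (Set ι)) : ind (secAt x true U) = fsec x true (ind U) := by
  funext ω
  have hm : ω ∈ secAt x true U ↔ insert x ω ∈ U := mem_secAt
  simp only [fsec, forceAt, cond_true]
  by_cases hω : insert x ω ∈ U
  · rw [ind_of_mem (hm.2 hω), ind_of_mem hω]
  · rw [ind_of_not_mem fun h => hω (hm.1 h), ind_of_not_mem hω]

omit [Fintype ι] in
/-- An essential coordinate has a non-vanishing section difference somewhere. [this work] -/
theorem exists_dsec_ne_zero {x : ι} {h : Set ι → ℝ} (hx : ¬ Ignores x h) : ∃ ω, dsec x h ω ≠ 0 := by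
  by_contra hall
  push Not at hall
  exact hx ((ignores_iff_dsec_eq_zero x h).2 (funext hall))

/-- **Step (c): not both `P₁` and `P₂` meet `U`** (induction on the number of coordinates essential for `U` but for neither `P_i`; base case by
the four-point obstruction). [this work] -/
theorem not_both_meet : ∀ (n : ℕ) (U : Set (Set ι)), P₁.Nonempty → P₂.Nonempty → IsUpperSet U → U.Nonempty → (∅ : Set ι) ∉ U →
    Identity P₁ P₂ U → (univ.filter fun x => ¬ Ignores x (ind U) ∧ Ignores x (ind P₁) ∧ Ignores x (ind P₂)).card = n →
    ¬ ((P₁ ∩ U).Nonempty ∧ (P₂ ∩ U).Nonempty) := by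
  intro n
  induction n using Nat.strong_induction_on with
  | _ n ih =>
  intro U hP₁ hP₂ hUup hUne hUns hI hcard hboth
  obtain ⟨hm₁, hm₂⟩ := hboth
  set S0 := univ.filter fun x => ¬ Ignores x (ind U) ∧ Ignores x (ind P₁) ∧ Ignores x (ind P₂) with hS0
  by_cases hn : S0.Nonempty
  · -- pass to the section `U^{x←1} ⊇ U`
    obtain ⟨x, hx⟩ := hn
    obtain ⟨hxU, hx₁, hx₂⟩ := (mem_filter.1 hx).2
    set U' := secAt x true U with hU'
    have hUU' : U ⊆ U' := fun ω hω => mem_secAt.2 (hUup (Set.subset_insert x ω) hω)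
    have hI' : Identity P₁ P₂ U' := identity_secAt hI hx₁ hx₂
    have hU'up : IsUpperSet U' := isUpperSet_secAt x true hUup
    have hsec : ind U' = fsec x true (ind U) := ind_secAt_true x U
    by_cases hsure : (∅ : Set ι) ∈ U'
    · -- a sure section contradicts the identity
      have hall : ∀ ω, ω ∈ U' := fun ω => hU'up (Set.empty_subset ω) hsure
      have h1 : ind U' = 1 := by funext ω; exact ind_of_mem (hall ω)
      have := hI' (halfParams ι) (halfParams_mem_Ioo ι)
      rw [h1, mul_one, mul_one, ex_one (sum_bernoulliWeight _), mul_one] at this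
      have hpos := mul_pos (ex_ind_pos (halfParams_mem_Ioo ι) hP₁) (ex_ind_pos (halfParams_mem_Ioo ι) hP₂)
      linarith
    · have hsub : (univ.filter fun y => ¬ Ignores y (ind U') ∧ Ignores y (ind P₁) ∧ Ignores y (ind P₂)) ⊆ S0.erase x := by
        intro y hy
        obtain ⟨hyU', hy₁, hy₂⟩ := (mem_filter.1 hy).2
        refine mem_erase.2 ⟨fun hyx => hyU' (by rw [hyx, hsec]; exact ignores_fsec x true _), mem_filter.2 ⟨mem_univ _, ?_, hy₁, hy₂⟩⟩
        intro hyU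
        refine hyU' fun ω => ?_
        rw [hsec]
        show ind U (insert x (insert y ω)) = ind U (insert x ω)
        rw [Set.insert_comm, hyU]
      have hlt : (univ.filter fun y => ¬ Ignores y (ind U') ∧ Ignores y (ind P₁) ∧ Ignores y (ind P₂)).card < n := by
        calc _ ≤ (S0.erase x).card := card_le_card hsub
          _ < S0.card := card_erase_lt_of_mem hx
          _ = n := hcard
      exact ih _ hlt U' hP₁ hP₂ hU'up (hUne.mono hUU') hsure hI' rfl
        ⟨hm₁.mono (Set.inter_subset_inter_right _ hUU'), hm₂.mono (Set.inter_subset_inter_right _ hUU')⟩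
  · -- every `U`-essential coordinate is essential for `P₁` or for `P₂`
    have hS0e : ∀ y, ¬ Ignores y (ind U) → ¬ Ignores y (ind P₁) ∨ ¬ Ignores y (ind P₂) := by
      intro y hyU
      by_contra h
      push Not at h
      exact hn ⟨y, mem_filter.2 ⟨mem_univ _, hyU, h.1, h.2⟩⟩
    have hid := poly_identity hI
    -- if `P₁ ⟂ U` then `P₂ ∩ U = ∅` (and symmetrically), contradicting `hm`
    by_cases h1 : ∀ y, Ignores y (ind P₁) ∨ Ignores y (ind U)
    · have hN : exPoly (ind P₁ * ind U) = exPoly (ind P₁) * exPoly (ind U) := exPoly_ind_mul_eq_of_ignores h1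
      rw [hN] at hid
      have hM : exPoly (ind P₁) * exPoly (ind P₂ * ind U) = 0 := by linear_combination hid
      have hz := exPoly_eq_zero_iff.1 ((mul_eq_zero.1 hM).resolve_left (exPoly_ind_ne_zero hP₁))
      obtain ⟨ω, hω₂, hωU⟩ := hm₂
      have := congrFun hz ω
      rw [Pi.mul_apply, ind_of_mem hω₂, ind_of_mem hωU, mul_one] at this
      exact one_ne_zero this
    by_cases h2 : ∀ y, Ignores y (ind P₂) ∨ Ignores y (ind U)
    · have hM : exPoly (ind P₂ * ind U) = exPoly (ind P₂) * exPoly (ind U) := exPoly_ind_mul_eq_of_ignores h2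
      rw [hM] at hid
      have hN : exPoly (ind P₂) * exPoly (ind P₁ * ind U) = 0 := by linear_combination hid
      have hz := exPoly_eq_zero_iff.1 ((mul_eq_zero.1 hN).resolve_left (exPoly_ind_ne_zero hP₂))
      obtain ⟨ω, hω₁, hωU⟩ := hm₁
      have := congrFun hz ω
      rw [Pi.mul_apply, ind_of_mem hω₁, ind_of_mem hωU, mul_one] at this
      exact one_ne_zero this
    push Not at h1 h2
    obtain ⟨s, hs₁, hsU⟩ := h1
    obtain ⟨t, ht₂, htU⟩ := h2
    have hs₂ : Ignores s (ind P₂) := by by_contra h; exact not_all_three hP₁ hP₂ hUne hI s hs₁ h hsU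
    have ht₁ : Ignores t (ind P₁) := by by_contra h; exact not_all_three hP₁ hP₂ hUne hI t h ht₂ htU
    have hst : s ≠ t := fun h => hs₁ (h ▸ ht₁)
    set F := ind U with hF
    set S2 : Finset ι := univ.filter fun y => ¬ Ignores y (ind P₂) with hS2
    -- `Δ_s F` ignores every `P₂`-essential coordinate (step (b) at `s`)
    have hds : ∀ y, y ∉ (univ \ S2) → Ignores y (dsec s F) := by
      intro y hy
      have hy₂ : ¬ Ignores y (ind P₂) := by
        have : y ∈ S2 := by by_contra h; exact hy (mem_sdiff.2 ⟨mem_univ _, h⟩)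
        exact (mem_filter.1 this).2
      exact ignores_dsec_of_essential hP₁ hP₂ hUne hI hs₁ hsU hy₂
    -- `Δ_t F` ignores every coordinate that is not `P₂`-essential
    have hdt : ∀ y, y ∉ S2 → Ignores y (dsec t F) := by
      intro y hy
      have hy₂ : Ignores y (ind P₂) := by by_contra h; exact hy (mem_filter.2 ⟨mem_univ _, h⟩)
      by_cases hyU : Ignores y (ind U)
      · exact ignores_dsec_of_ignores hyU
      · have hy₁ : ¬ Ignores y (ind P₁) := (hS0e y hyU).resolve_right (not_not.2 hy₂)
        have hyt : y ≠ t := fun h => by subst h; exact hy (mem_filter.2 ⟨mem_univ _, ht₂⟩)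
        -- step (b) at `x = y`: `Δ_y F` ignores `t`; by symmetry of the mixed difference, `Δ_t F` ignores `y`
        have h' : Ignores t (dsec y F) := ignores_dsec_of_essential hP₁ hP₂ hUne hI hy₁ hyU ht₂
        exact (ignores_dsec_iff_mixed (Ne.symm hyt) F).2 (((ignores_dsec_iff_mixed hyt F).1 h').symm)
    -- witnesses of essentiality, combined into one configuration
    obtain ⟨η, hη⟩ := exists_dsec_ne_zero hsU
    obtain ⟨η', hη'⟩ := exists_dsec_ne_zero htU
    set ζ₀ : Set ι := (η' ∩ ↑S2) ∪ (η \ ↑S2) with hζ₀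
    have hζ₀t : dsec t F ζ₀ = dsec t F η' :=
      apply_eq_of_inter_eq hdt (by
        ext i; simp only [hζ₀, Set.mem_inter_iff, Set.mem_union, Set.mem_sdiff, mem_coe]; tauto)
    have hζ₀s : dsec s F ζ₀ = dsec s F η :=
      apply_eq_of_inter_eq hds (by
        ext i; simp only [hζ₀, Set.mem_inter_iff, Set.mem_union, Set.mem_sdiff, mem_coe, coe_sdiff, coe_univ, Set.mem_univ, true_and]
        tauto)
    have hsS : s ∉ S2 := fun h => (mem_filter.1 h).2 hs₂
    have htS : t ∈ S2 := mem_filter.2 ⟨mem_univ _, ht₂⟩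
    set ζ : Set ι := (ζ₀ \ {s}) \ {t} with hζ
    have hζs : s ∉ ζ := fun h => h.1.2 rfl
    have hζt : t ∉ ζ := fun h => h.2 rfl
    have hvs : dsec s F ζ = dsec s F ζ₀ := by
      rw [hζ, (hds t (fun h => (mem_sdiff.1 h).2 htS)).sdiff, (ignores_dsec s F).sdiff]
    have hvt : dsec t F ζ = dsec t F ζ₀ := by
      rw [hζ, (ignores_dsec t F).sdiff, (hdt s hsS).sdiff]
    have hjs : F (insert s ζ) ≠ F ζ := by
      have := hvs.trans hζ₀s
      simp only [dsec, Pi.sub_apply, fsec, forceAt, cond_true, cond_false, Set.sdiff_singleton_eq_self hζs] at this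
      intro h; rw [h, sub_self] at this; exact hη this.symm
    have hjt : F (insert t ζ) ≠ F ζ := by
      have := hvt.trans hζ₀t
      simp only [dsec, Pi.sub_apply, fsec, forceAt, cond_true, cond_false, Set.sdiff_singleton_eq_self hζt] at this
      intro h; rw [h, sub_self] at this; exact hη' this.symm
    have hmix : F (insert s (insert t ζ)) - F (insert t ζ) = F (insert s ζ) - F ζ :=
      (ignores_dsec_iff_mixed hst F).1 (hds t fun h => (mem_sdiff.1 h).2 htS) ζ hζs hζt
    exact four_point hjs hjt hmix

/-- **THEOREM R₃ (rigidity of the `t²`-identity).**  Let `P₁, P₂` be nonempty events and `U` a nonempty, non-sure increasing event of a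
finite cube such that `E_p(1_{P₁})E_p(1_{P₂}1_U) + E_p(1_{P₂})E_p(1_{P₁}1_U) = E_p(1_{P₁})E_p(1_{P₂})E_p(1_U)` for every interior product
measure `μ_p`.  Then for some `{i,j} = {1,2}`: no coordinate is essential for both `P_i` and `U`, and `P_j ∩ U = ∅`. [this work] -/
theorem rigidity_three {U : Set (Set ι)} (hP₁ : P₁.Nonempty) (hP₂ : P₂.Nonempty) (hUup : IsUpperSet U) (hUne : U.Nonempty)
    (hUns : (∅ : Set ι) ∉ U) (hI : Identity P₁ P₂ U) :
    ((∀ y, Ignores y (ind P₁) ∨ Ignores y (ind U)) ∧ P₂ ∩ U = ∅) ∨ ((∀ y, Ignores y (ind P₂) ∨ Ignores y (ind U)) ∧ P₁ ∩ U = ∅) := by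
  have hnb := not_both_meet (P₁ := P₁) (P₂ := P₂) _ U hP₁ hP₂ hUup hUne hUns hI rfl
  have hid := poly_identity hI
  rw [not_and_or, Set.not_nonempty_iff_eq_empty, Set.not_nonempty_iff_eq_empty] at hnb
  have evalI : ∀ {f g : Set ι → ℝ}, exPoly (f * g) = exPoly f * exPoly g →
      ∀ p : ι → unitInterval, (∀ e, (p e : ℝ) ∈ Set.Ioo (0 : ℝ) 1) →
        ex (bernoulliWeight p) (f * g) = ex (bernoulliWeight p) f * ex (bernoulliWeight p) g := by
    intro f g h p _
    have := congrArg (MvPolynomial.eval fun i => (p i : ℝ)) h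
    simp only [map_mul, eval_exPoly] at this
    exact this
  have zero_of_empty : ∀ {A : Set (Set ι)}, A ∩ U = ∅ → exPoly (ind A * ind U) = 0 := by
    intro A hA
    rw [exPoly_eq_zero_iff]
    funext ω
    rw [Pi.mul_apply, Pi.zero_apply]
    by_cases h1 : ω ∈ A
    · by_cases h2 : ω ∈ U
      · exact absurd (show ω ∈ A ∩ U from ⟨h1, h2⟩) (by rw [hA]; exact Set.notMem_empty ω)
      · rw [ind_of_not_mem h2, mul_zero]
    · rw [ind_of_not_mem h1, zero_mul]
  rcases hnb with h | h
  · -- `P₁ ∩ U = ∅`: then `N = 0`, so `E1·M = E1·E2·W`, `M = E2·W`, and Fact 1 for `(P₂, U)`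
    right
    refine ⟨fun y => ?_, h⟩
    rw [zero_of_empty h, mul_zero, add_zero] at hid
    have hM : exPoly (ind P₂ * ind U) = exPoly (ind P₂) * exPoly (ind U) := by
      have : exPoly (ind P₁) * (exPoly (ind P₂ * ind U) - exPoly (ind P₂) * exPoly (ind U)) = 0 := by linear_combination hid
      exact sub_eq_zero.1 ((mul_eq_zero.1 this).resolve_left (exPoly_ind_ne_zero hP₁))
    exact ignores_or_ignores_of_forall_interior_ex_mul_eq (evalI hM) y
  · left
    refine ⟨fun y => ?_, h⟩
    rw [zero_of_empty h, mul_zero, zero_add] at hid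
    have hN : exPoly (ind P₁ * ind U) = exPoly (ind P₁) * exPoly (ind U) := by
      have : exPoly (ind P₂) * (exPoly (ind P₁ * ind U) - exPoly (ind P₁) * exPoly (ind U)) = 0 := by linear_combination hid
      exact sub_eq_zero.1 ((mul_eq_zero.1 this).resolve_left (exPoly_ind_ne_zero hP₂))
    exact ignores_or_ignores_of_forall_interior_ex_mul_eq (evalI hN) y

end Assembly

end RigidityR3

end Summit.CriticalPhenomena.PercolationContinuityZ3.Theorems
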